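import Literature.Geometry.GaugeTheory.SpincStructureDiracAdjoint
import Literature.Geometry.GaugeTheory.SpincStructureDivergence
import Literature.Geometry.GaugeTheory.SeibergWittenGaugeInvariance
import HarnessLib

/-!
# The Dirac operator on `γ(a)u₀`: the `u₁`-component of `∂_{A₀}(γ(a)u₀)`

For a compatible system of adapted frames `𝔞` (almost complex `4`-manifold, Taubes's canonical
`Spin^c` structure `S⁺ = I ⊕ K⁻¹`, canonical spinor `u₀`, canonical connection `A₀` with
`∇̃^{A₀}u₀ = b ⊗ u₁`, Taubes 1994 §1 (1)), a real 1-form `a` and a chart `U_i ∋ x` with frame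
`e = e^{(i)}`, we compute the `u₁ = K⁻¹`-component of the local Dirac operator applied to the local
section `y ↦ γ(a)(y)u₀ = Σ_j a(e_j) γ_j u₀` of `S⁻`:

`(∂_{A₀}(γ(a)u₀))_{u₁} = (da)⁺₁ + i (da)⁺₂ - Σ_k a(e_k) b(e_k) + i(a(e₁)b(e₀) - a(e₀)b(e₁)) + i(a(e₃)b(e₂) - a(e₂)b(e₃))`

(`(da)⁺₁ = da(e₀,e₂) + da(e₃,e₁)`, `(da)⁺₂ = da(e₀,e₃) + da(e₁,e₂)`: the `(0,2)`-part of `da`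
read through `ρ⁺`, `(ρ(da)u₀)_{u₁} = (da)⁺₁ + i(da)⁺₂`; `b = ` Taubes's torsion form).  This is the
Clifford–Leibniz rule `∂(γ(a)u₀) = γ(da + d^*a)u₀ - 2∇_{a♯}u₀ + …` (Morgan 1996, Lemma 3.3.2 and
§3.3; Lawson–Michelsohn II.5) made explicit in the frame: the derivative falls on the coefficients
`a(e_j)` (giving, with the bracket formula `[e_k, e_j] = Σ_m(ω̃_{mj}(e_k) - ω̃_{mk}(e_j))e_m` and
Warner's formula for `da`, the term `ρ(da)u₀` — the Levi-Civita terms `[a_i(e_k), γ_j] = γ(∇_{e_k}e_j)`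
of Lemma 3.2.4 cancel exactly against the bracket term of `da`), and on `u₀` (giving the torsion
terms through `∇̃^{A₀}_{e_k}u₀ = b(e_k)u₁`).  It is the linear-algebra input of the linearised
uniqueness argument at Taubes's solution (Taubes 1994, §3: "the same arguments (but linearized)
will show that `(A₀, u₀)` is a nondegenerate solution").

## References
* J. W. Morgan, *The Seiberg–Witten equations and applications to the topology of smooth
  four-manifolds*, Princeton Math. Notes 44 (1996), §3.2 (3.2), Lemma 3.2.4, §3.3.
* C. H. Taubes, Math. Res. Lett. 1 (1994) 809–822, §1 (1), §3.
-/

open scoped Manifold ContDiff Topology ComplexConjugate Matrix Quaternion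
open Set Function Filter Complex Bundle
open Literature.Geometry.Lorentzian (PseudoRiemannianMetric)
open Literature.Topology.FourManifolds (SmoothOrientation)

namespace Literature.Geometry.GaugeTheory

/-! ### Clifford tables: the `u₁`-components of `γ_kγ_j u₀` and `γ_kγ_j u₁` -/

/-- `u₁ = (1, 0; 0, 0)` as a block vector. [folklore] -/
theorem detUnit_eq_sumElim : detUnit = Sum.elim ![(1 : ℂ), 0] 0 := by
  ext (a | a) <;> fin_cases a <;> simp [detUnit]

/-- The table `(γ_kγ_j u₀)_{u₁}`: rows `k`, columns `j`. [cite: MorganSWBook1996, §2.4 Example (ii)] -/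
def gammaGammaPlusUnitTable (k j : Fin 4) : ℂ :=
  !![0, 0, 1, I; 0, 0, I, -1; -1, -I, 0, 0; -I, 1, 0, 0] k j

/-- The table `(γ_kγ_j u₁)_{u₁}`: rows `k`, columns `j`. [cite: MorganSWBook1996, §2.4 Example (ii)] -/
def gammaGammaDetUnitTable (k j : Fin 4) : ℂ :=
  !![-1, I, 0, 0; -I, -1, 0, 0; 0, 0, -1, I; 0, 0, -I, -1] k j

/-- `(γ_kγ_j u₀)_{u₁}` from the fibre model `γ(x) = (0, m(x); -m(x)ᴴ, 0)`. [cite: MorganSWBook1996, §2.4 Example (ii)] -/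
theorem cliffordBasis_mul_cliffordBasis_mulVec_plusUnit_inl_zero (k j : Fin 4) :
    ((cliffordBasis k * cliffordBasis j) *ᵥ plusUnit) (Sum.inl 0) = gammaGammaPlusUnitTable k j := by
  rw [← Matrix.mulVec_mulVec]
  fin_cases k <;> fin_cases j <;>
    simp [cliffordBasis, cliffordGamma, gammaGammaPlusUnitTable, plusUnit, Pi.single_apply, Matrix.mulVec, dotProduct,
      Fintype.sum_sum_type, Fin.sum_univ_two, Matrix.fromBlocks, Matrix.conjTranspose_apply, Complex.ext_iff,
      Complex.mul_re, Complex.mul_im, Complex.conj_re, Complex.conj_im]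

/-- `(γ_kγ_j u₁)_{u₁}` from the fibre model. [cite: MorganSWBook1996, §2.4 Example (ii)] -/
theorem cliffordBasis_mul_cliffordBasis_mulVec_detUnit_inl_zero (k j : Fin 4) :
    ((cliffordBasis k * cliffordBasis j) *ᵥ detUnit) (Sum.inl 0) = gammaGammaDetUnitTable k j := by
  rw [← Matrix.mulVec_mulVec, detUnit_eq_sumElim]
  fin_cases k <;> fin_cases j <;>
    simp [cliffordBasis, cliffordGamma, gammaGammaDetUnitTable, Matrix.mulVec, dotProduct, Fin.sum_univ_two,
      Matrix.conjTranspose_apply, Complex.ext_iff, Complex.mul_re, Complex.mul_im, Complex.conj_re, Complex.conj_im]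

/-- **Contraction against `(γ_kγ_j u₀)_{u₁}`** picks out the `(0,2)`-combination
`(M₀₂ - M₂₀) + i(M₀₃ - M₃₀) + i(M₁₂ - M₂₁) - (M₁₃ - M₃₁)` (for antisymmetric `M`: `2((M⁺)₁ + i(M⁺)₂)`).
[cite: MorganSWBook1996, Lemma 2.3.4] -/
theorem sum_gammaGammaPlusUnitTable_mul (M : Fin 4 → Fin 4 → ℂ) :
    ∑ k, ∑ j, gammaGammaPlusUnitTable k j * M k j =
      (M 0 2 - M 2 0) + I * (M 0 3 - M 3 0) + I * (M 1 2 - M 2 1) - (M 1 3 - M 3 1) := by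
  simp [gammaGammaPlusUnitTable, Fin.sum_univ_four]
  ring

/-- **Contraction against `(γ_kγ_j u₁)_{u₁}`**: `-tr M + i(M₀₁ - M₁₀) + i(M₂₃ - M₃₂)`.
[cite: MorganSWBook1996, Lemma 2.3.4] -/
theorem sum_gammaGammaDetUnitTable_mul (M : Fin 4 → Fin 4 → ℂ) :
    ∑ k, ∑ j, gammaGammaDetUnitTable k j * M k j =
      -(M 0 0 + M 1 1 + M 2 2 + M 3 3) + I * (M 0 1 - M 1 0) + I * (M 2 3 - M 3 2) := by
  simp [gammaGammaDetUnitTable, Fin.sum_univ_four]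
  ring

/-- The table `(γ_kγ_j u₀)_{u₁}` is antisymmetric (`γ_kγ_j + γ_jγ_k = -2δ_{kj}` and `(u₀)_{u₁} = 0`). [folklore] -/
theorem gammaGammaPlusUnitTable_antisymm (k j : Fin 4) :
    gammaGammaPlusUnitTable k j = -gammaGammaPlusUnitTable j k := by
  fin_cases k <;> fin_cases j <;> simp [gammaGammaPlusUnitTable]

/-- **The index identity behind `γ ∘ ∇(γ(a)u₀) = ρ(da)u₀ + …`**: for an antisymmetric table `c`,
coefficients `D_{kj} = e_k(a(e_j))`, Levi-Civita coefficients `W_{kmj} = ω̃_{mj}(e_k)` antisymmetric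
in `(m, j)` and values `A_m = a(e_m)`,
`Σ c_{kj} D_{kj} + Σ A_j W_{kmj} c_{km} = ½ Σ c_{kj} (D_{kj} - D_{jk} - Σ_m (W_{kmj} - W_{jmk}) A_m)` —
the right side is `½ Σ c_{kj} da(e_k, e_j)` by Warner's formula and the bracket formula. [folklore] -/
theorem sum_antisymm_bracket_identity (c D : Fin 4 → Fin 4 → ℂ) (W : Fin 4 → Fin 4 → Fin 4 → ℂ) (A : Fin 4 → ℂ)
    (hc : ∀ k j, c k j = -c j k) (hW : ∀ k m j, W k m j = -W k j m) :
    ∑ k, ∑ j, c k j * D k j + ∑ k, ∑ j, ∑ m, A j * W k m j * c k m =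
      2⁻¹ * ∑ k, ∑ j, c k j * (D k j - D j k - ∑ m, (W k m j - W j m k) * A m) := by
  -- `Σ c_{kj} D_{jk} = -Σ c_{kj} D_{kj}`
  have h1 : ∑ k, ∑ j, c k j * D j k = -∑ k, ∑ j, c k j * D k j := by
    rw [Finset.sum_comm, ← Finset.sum_neg_distrib]
    refine Finset.sum_congr rfl fun k _ ↦ ?_
    rw [← Finset.sum_neg_distrib]
    refine Finset.sum_congr rfl fun j _ ↦ ?_
    rw [hc j k]; ring
  -- `Σ c_{kj} W_{jmk} A_m = -Σ c_{kj} W_{kmj} A_m`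
  have h2 : ∑ k, ∑ j, c k j * ∑ m, W j m k * A m = -∑ k, ∑ j, c k j * ∑ m, W k m j * A m := by
    rw [Finset.sum_comm, ← Finset.sum_neg_distrib]
    refine Finset.sum_congr rfl fun k _ ↦ ?_
    rw [← Finset.sum_neg_distrib]
    refine Finset.sum_congr rfl fun j _ ↦ ?_
    rw [hc j k]; ring
  -- `Σ A_j W_{kmj} c_{km} = -Σ c_{kj} W_{kmj} A_j` (rename, antisymmetry of `W`)
  have h3 : ∑ k, ∑ j, ∑ m, A j * W k m j * c k m = -∑ k, ∑ j, c k j * ∑ m, W k m j * A m := by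
    rw [← Finset.sum_neg_distrib]
    refine Finset.sum_congr rfl fun k _ ↦ ?_
    rw [Finset.sum_comm, ← Finset.sum_neg_distrib]
    refine Finset.sum_congr rfl fun m _ ↦ ?_
    rw [Finset.mul_sum, ← Finset.sum_neg_distrib]
    refine Finset.sum_congr rfl fun j _ ↦ ?_
    rw [hW k j m]; ring
  have hsplit : ∑ k, ∑ j, c k j * (D k j - D j k - ∑ m, (W k m j - W j m k) * A m) =
      ∑ k, ∑ j, c k j * D k j - ∑ k, ∑ j, c k j * D j k -
        (∑ k, ∑ j, c k j * ∑ m, W k m j * A m - ∑ k, ∑ j, c k j * ∑ m, W j m k * A m) := by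
    simp only [← Finset.sum_sub_distrib, ← mul_sub, sub_mul]
  rw [hsplit, h1, h2, h3]
  ring

section

variable {X : Type*} [TopologicalSpace X] [ChartedSpace (EuclideanSpace ℝ (Fin 4)) X] [IsManifold (𝓡 4) ∞ X]
  {g : PseudoRiemannianMetric (𝓡 4) ∞ (EuclideanSpace ℝ (Fin 4)) (TangentSpace (𝓡 4) : X → Type _)}
  {o : SmoothOrientation (𝓡 4) X} {J : Π x : X, TangentSpace (𝓡 4) x →ₗ[ℝ] TangentSpace (𝓡 4) x}
  {ι : Type*}

namespace AdaptedFrames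

variable (𝔞 : AdaptedFrames g o J ι) [g.HasLeviCivita]

/-- **The local section `γ(a)u₀` of `S⁻`** in the chart `i`: `y ↦ Σ_j a(e_j(y)) γ_j u₀`. [cite: MorganSWBook1996, §3.3 (3.1)] -/
noncomputable def cliffordPlusUnitFun (a : RealOneForm X) (i : ι) : X → Spinor → ℂ :=
  fun y ↦ SpincStructure.cliffordOneForm a y (fun k ↦ 𝔞.frame i k y) *ᵥ plusUnit

omit [g.HasLeviCivita] in
/-- `γ(a)u₀ = Σ_j a(e_j) γ_j u₀`. [cite: MorganSWBook1996, §3.3 (3.1)] -/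
theorem cliffordPlusUnitFun_eq (a : RealOneForm X) (i : ι) :
    𝔞.cliffordPlusUnitFun a i = fun y ↦ ∑ j, (((a y (𝔞.frame i j y) : ℝ) : ℂ)) • (cliffordBasis j *ᵥ plusUnit) := by
  funext y
  simp [cliffordPlusUnitFun, SpincStructure.cliffordOneForm, Matrix.sum_mulVec, Matrix.smul_mulVec]

/-- The connection matrix of `A₀` acts on `u₀` by `a_i(v)u₀ = ∇̃^{A₀}_v u₀ = b(v)u₁`. [cite: Taubes1994, §1 (1)] -/
theorem connMatrix_canonicalConnection_mulVec_plusUnit (i : ι) (x : X) (v : TangentSpace (𝓡 4) x) :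
    𝔞.toSpincStructure.connMatrix 𝔞.canonicalConnection i x v *ᵥ plusUnit = 𝔞.canonicalTorsion i x v • detUnit := by
  have h := 𝔞.covDeriv_canonicalConnection_canonicalSpinor i x v
  rw [SpincStructure.covDeriv_eq_localCovDeriv, SpincStructure.localCovDeriv] at h
  have h0 : spinorDeriv (𝔞.canonicalSpinor.toFun i) x v = 0 := by
    funext s; simp [spinorDeriv, canonicalSpinor_toFun]
  rwa [h0, zero_add, canonicalSpinor_toFun] at h

/-- **The Leibniz expansion of `∇̃^{A₀}_v(γ(a)u₀)`** in the frame of a chart `U_i ∋ x`: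
`∇̃_v(Σ_j a(e_j)γ_ju₀) = Σ_j [v(a(e_j)) γ_ju₀ + a(e_j)(b(v) γ_ju₁ + Σ_m ω̃_{mj}(v) γ_mu₀)]`
(Morgan 1996, (3.2) and Lemma 3.2.4: `[a_i(v), γ_j] = γ(∇_v e_j) = Σ_m ω̃_{mj}(v)γ_m`; Taubes's (1):
`a_i(v)u₀ = b(v)u₁`). [cite: MorganSWBook1996, §3.2 (3.2), Lemma 3.2.4] [cite: Taubes1994, §1 (1)] -/
theorem localCovDeriv_cliffordPlusUnitFun (a : RealOneForm X) {i : ι} {x : X} (hx : x ∈ 𝔞.baseSet i)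
    (ha : a.SmoothAt x) (v : TangentSpace (𝓡 4) x) :
    𝔞.toSpincStructure.localCovDeriv 𝔞.canonicalConnection i (𝔞.cliffordPlusUnitFun a i) x v =
      ∑ j, ((((RealOneForm.ofFun (fun y ↦ a y (𝔞.frame i j y)) x v : ℝ) : ℂ)) • (cliffordBasis j *ᵥ plusUnit) +
        (((a x (𝔞.frame i j x) : ℝ) : ℂ)) •
          (𝔞.canonicalTorsion i x v • (cliffordBasis j *ᵥ detUnit) +
            ∑ m, ((𝔞.toSpincStructure.lcForm i x v m j : ℝ) : ℂ) • (cliffordBasis m *ᵥ plusUnit))) := by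
  have hf : ∀ j, MDifferentiableAt (𝓡 4) 𝓘(ℝ, ℝ) (fun y ↦ a y (𝔞.frame i j y)) x := fun j ↦
    𝔞.toSpincStructure.mdifferentiableAt_form_frame ha i j hx
  have hfc : ∀ j, MDifferentiableAt (𝓡 4) 𝓘(ℝ, ℂ) (fun y ↦ (((a y (𝔞.frame i j y) : ℝ) : ℂ))) x := fun j ↦
    ((Complex.ofRealCLM : ℝ →L[ℝ] ℂ).hasMFDerivAt.comp x (hf j).hasMFDerivAt).mdifferentiableAt
  have hconst : ∀ j, SpinorMDiffAt (fun _ : X ↦ cliffordBasis j *ᵥ plusUnit) x := fun j s ↦ mdifferentiableAt_const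
  have hterm : ∀ j, SpinorMDiffAt (fun y ↦ (((a y (𝔞.frame i j y) : ℝ) : ℂ)) • (cliffordBasis j *ᵥ plusUnit)) x :=
    fun j s ↦ (hfc j).mul (mdifferentiableAt_const (c := (cliffordBasis j *ᵥ plusUnit) s))
  rw [cliffordPlusUnitFun_eq, SpincStructure.localCovDeriv,
    spinorDeriv_finset_sum Finset.univ (fun j _ ↦ hterm j) v, Matrix.mulVec_sum, ← Finset.sum_add_distrib]
  refine Finset.sum_congr rfl fun j _ ↦ ?_
  have hd : spinorDeriv (fun _ : X ↦ cliffordBasis j *ᵥ plusUnit) x v = 0 := by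
    funext s; simp [spinorDeriv]
  rw [spinorDeriv_smul_fun (hfc j) (hconst j) v, hd, smul_zero, add_zero, complexDeriv_ofReal_comp (hf j) v,
    Matrix.mulVec_smul]
  congr 1
  -- `a_i(v)(γ_j u₀) = γ_j (a_i(v) u₀) + [a_i(v), γ_j] u₀`
  have hcomm : 𝔞.toSpincStructure.connMatrix 𝔞.canonicalConnection i x v *ᵥ (cliffordBasis j *ᵥ plusUnit) =
      cliffordBasis j *ᵥ (𝔞.toSpincStructure.connMatrix 𝔞.canonicalConnection i x v *ᵥ plusUnit) +
        (𝔞.toSpincStructure.connMatrix 𝔞.canonicalConnection i x v * cliffordBasis j -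
          cliffordBasis j * 𝔞.toSpincStructure.connMatrix 𝔞.canonicalConnection i x v) *ᵥ plusUnit := by
    rw [Matrix.mulVec_mulVec, Matrix.mulVec_mulVec, Matrix.sub_mulVec]; abel
  rw [hcomm, 𝔞.connMatrix_canonicalConnection_mulVec_plusUnit, Matrix.mulVec_smul,
    𝔞.toSpincStructure.connMatrix_mul_cliffordBasis_sub _ hx v j, Matrix.sum_mulVec]
  simp only [Matrix.smul_mulVec]

omit [g.HasLeviCivita] in
/-- The frames of the `Spin^c` structure of `𝔞` are the frames of `𝔞` (definitional). [folklore] -/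
@[simp] theorem toSpincStructure_frame : 𝔞.toSpincStructure.frame = 𝔞.frame := rfl

omit [g.HasLeviCivita] in
/-- Antisymmetry of `da(e_k, e_j)`. [folklore] -/
theorem extDeriv_frame_swap (a : RealOneForm X) (i : ι) (x : X) (k j : Fin 4) :
    a.extDeriv x (𝔞.frame i j x) (𝔞.frame i k x) = -a.extDeriv x (𝔞.frame i k x) (𝔞.frame i j x) :=
  mform_two_swap _ x _ _

/-- **Warner's formula for `da` on the frame, with the bracket expanded**:
`da(e_k, e_j) = e_k(a(e_j)) - e_j(a(e_k)) - Σ_m (ω̃_{mj}(e_k) - ω̃_{mk}(e_j)) a(e_m)`.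
[cite: Warner1983, Prop. 2.25(f)] [cite: MorganSWBook1996, §3.2] -/
theorem extDeriv_frame_eq (a : RealOneForm X) {i : ι} {x : X} (hx : x ∈ 𝔞.baseSet i) (ha : a.SmoothAt x) (k j : Fin 4) :
    a.extDeriv x (𝔞.frame i k x) (𝔞.frame i j x) =
      RealOneForm.ofFun (fun y ↦ a y (𝔞.frame i j y)) x (𝔞.frame i k x) -
        RealOneForm.ofFun (fun y ↦ a y (𝔞.frame i k y)) x (𝔞.frame i j x) -
          ∑ m, (𝔞.toSpincStructure.lcForm i x (𝔞.frame i k x) m j - 𝔞.toSpincStructure.lcForm i x (𝔞.frame i j x) m k) *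
            a x (𝔞.frame i m x) := by
  have hw := RealOneForm.extDeriv_eq_ofFun_sub ha (𝔞.toSpincStructure.mdifferentiableAt_frame i k hx)
    (𝔞.toSpincStructure.mdifferentiableAt_frame i j hx)
  have hb := 𝔞.toSpincStructure.mlieBracket_frame i hx k j
  simp only [toSpincStructure_frame] at hw hb
  rw [hw, hb, map_sum]
  simp only [map_smul, smul_eq_mul]

/-- **The `u₁`-component of `∂_{A₀}(γ(a)u₀)`** at a point of the chart `U_i`:
`(∂_{A₀}(γ(a)u₀))_{u₁} = (da)⁺₁ + i(da)⁺₂ - Σ_k a_k b_k + i(a₁b₀ - a₀b₁) + i(a₃b₂ - a₂b₃)`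
(`a_k = a(e_k)`, `b_k = b(e_k)`; `(da)⁺₁ + i(da)⁺₂ = (ρ(da)u₀)_{u₁}` is the `(0,2)`-part of `da`).
The Levi-Civita terms cancel against the bracket term of Warner's formula (`sum_antisymm_bracket_identity`).
[cite: MorganSWBook1996, §3.2 (3.2), Lemma 3.2.4, §3.3] [cite: Taubes1994, §1 (1), §3] -/
theorem localDirac_cliffordPlusUnitFun_inl_zero (a : RealOneForm X) {i : ι} {x : X} (hx : x ∈ 𝔞.baseSet i)
    (ha : a.SmoothAt x) :
    𝔞.toSpincStructure.localDirac 𝔞.canonicalConnection i (𝔞.cliffordPlusUnitFun a i) x (Sum.inl 0) =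
      ((sdCoeff (𝔞.toSpincStructure.extDerivMatrix a i x) 1 : ℝ) : ℂ) +
          I * ((sdCoeff (𝔞.toSpincStructure.extDerivMatrix a i x) 2 : ℝ) : ℂ) +
        (-(∑ k, ((a x (𝔞.frame i k x) : ℝ) : ℂ) * 𝔞.canonicalTorsion i x (𝔞.frame i k x)) +
          I * (((a x (𝔞.frame i 1 x) : ℝ) : ℂ) * 𝔞.canonicalTorsion i x (𝔞.frame i 0 x) -
            ((a x (𝔞.frame i 0 x) : ℝ) : ℂ) * 𝔞.canonicalTorsion i x (𝔞.frame i 1 x)) +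
          I * (((a x (𝔞.frame i 3 x) : ℝ) : ℂ) * 𝔞.canonicalTorsion i x (𝔞.frame i 2 x) -
            ((a x (𝔞.frame i 2 x) : ℝ) : ℂ) * 𝔞.canonicalTorsion i x (𝔞.frame i 3 x))) := by
  -- abbreviations (as functions of the indices)
  obtain ⟨D, hD⟩ : ∃ D : Fin 4 → Fin 4 → ℂ,
      D = fun k j ↦ (((RealOneForm.ofFun (fun y ↦ a y (𝔞.frame i j y)) x (𝔞.frame i k x) : ℝ) : ℂ)) := ⟨_, rfl⟩
  obtain ⟨A, hA⟩ : ∃ A : Fin 4 → ℂ, A = fun j ↦ (((a x (𝔞.frame i j x) : ℝ) : ℂ)) := ⟨_, rfl⟩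
  obtain ⟨W, hW⟩ : ∃ W : Fin 4 → Fin 4 → Fin 4 → ℂ,
      W = fun k m j ↦ (((𝔞.toSpincStructure.lcForm i x (𝔞.frame i k x) m j : ℝ) : ℂ)) := ⟨_, rfl⟩
  obtain ⟨τ, hτ⟩ : ∃ τ : Fin 4 → ℂ, τ = fun k ↦ 𝔞.canonicalTorsion i x (𝔞.frame i k x) := ⟨_, rfl⟩
  obtain ⟨E, hE⟩ : ∃ E : Fin 4 → Fin 4 → ℂ, E = fun k j ↦ (((a.extDeriv x (𝔞.frame i k x) (𝔞.frame i j x) : ℝ) : ℂ)) :=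
    ⟨_, rfl⟩
  -- Step 1: the component as explicit finite sums
  have hpt : ∀ k, (cliffordBasis k *ᵥ
      𝔞.toSpincStructure.localCovDeriv 𝔞.canonicalConnection i (𝔞.cliffordPlusUnitFun a i) x (𝔞.frame i k x)) (Sum.inl 0) =
      ∑ j, (gammaGammaPlusUnitTable k j * D k j + A j * τ k * gammaGammaDetUnitTable k j +
        ∑ m, A j * W k m j * gammaGammaPlusUnitTable k m) := by
    intro k
    rw [𝔞.localCovDeriv_cliffordPlusUnitFun a hx ha, Matrix.mulVec_sum, Finset.sum_apply]
    refine Finset.sum_congr rfl fun j _ ↦ ?_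
    simp only [Matrix.mulVec_add, Matrix.mulVec_smul, Matrix.mulVec_sum, Matrix.mulVec_mulVec, Pi.add_apply,
      Pi.smul_apply, Finset.sum_apply, smul_eq_mul, cliffordBasis_mul_cliffordBasis_mulVec_plusUnit_inl_zero,
      cliffordBasis_mul_cliffordBasis_mulVec_detUnit_inl_zero]
    rw [hD, hA, hW, hτ]
    simp only [mul_add, Finset.mul_sum, ← add_assoc]
    exact congrArg₂ (· + ·) (by ring) (Finset.sum_congr rfl fun m _ ↦ by ring)
  have hsum : 𝔞.toSpincStructure.localDirac 𝔞.canonicalConnection i (𝔞.cliffordPlusUnitFun a i) x (Sum.inl 0) =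
      (∑ k, ∑ j, gammaGammaPlusUnitTable k j * D k j + ∑ k, ∑ j, ∑ m, A j * W k m j * gammaGammaPlusUnitTable k m) +
        ∑ k, ∑ j, gammaGammaDetUnitTable k j * (A j * τ k) := by
    rw [SpincStructure.localDirac, Finset.sum_apply]
    simp only [toSpincStructure_frame, hpt, Finset.sum_add_distrib]
    have h2 : ∑ k, ∑ j, A j * τ k * gammaGammaDetUnitTable k j = ∑ k, ∑ j, gammaGammaDetUnitTable k j * (A j * τ k) :=
      Finset.sum_congr rfl fun k _ ↦ Finset.sum_congr rfl fun j _ ↦ by ring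
    rw [h2]
    ring
  -- Step 2: the Levi-Civita terms and the derivative terms combine to `½ Σ c_{kj} da(e_k,e_j)`
  have hc : ∀ k j, gammaGammaPlusUnitTable k j = -gammaGammaPlusUnitTable j k := gammaGammaPlusUnitTable_antisymm
  have hWa : ∀ k m j, W k m j = -W k j m := by
    intro k m j
    rw [hW]
    simp only
    rw [(𝔞.toSpincStructure.isTwoForm_lcForm i hx (𝔞.frame i k x)).apply_swap j m]
    push_cast
    ring
  have hEeq : ∀ k j, D k j - D j k - ∑ m, (W k m j - W j m k) * A m = E k j := by
    intro k j
    rw [hE, hD, hW, hA]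
    simp only
    rw [𝔞.extDeriv_frame_eq a hx ha k j]
    push_cast
    ring
  have h12 : ∑ k, ∑ j, gammaGammaPlusUnitTable k j * D k j +
      ∑ k, ∑ j, ∑ m, A j * W k m j * gammaGammaPlusUnitTable k m = 2⁻¹ * ∑ k, ∑ j, gammaGammaPlusUnitTable k j * E k j := by
    rw [sum_antisymm_bracket_identity _ D W A hc hWa]
    simp only [hEeq]
  -- Step 3: contract with the tables
  have hEa : ∀ k j, E j k = -E k j := by
    intro k j; rw [hE]; simp only; rw [𝔞.extDeriv_frame_swap a i x k j]; push_cast; ring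
  rw [hsum, h12, sum_gammaGammaPlusUnitTable_mul, sum_gammaGammaDetUnitTable_mul,
    hEa 0 2, hEa 0 3, hEa 1 2, hEa 1 3]
  simp only [sdCoeff, SpincStructure.extDerivMatrix_apply, toSpincStructure_frame, Matrix.cons_val_zero, Matrix.cons_val_one,
    Matrix.head_cons, Matrix.cons_val_two, Matrix.tail_cons, hE, hA, hτ, Fin.sum_univ_four]
  rw [𝔞.extDeriv_frame_swap a i x 1 3]
  push_cast
  ring

end AdaptedFrames

end

end Literature.Geometry.GaugeTheory
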